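import Summits.CriticalPhenomena.PercolationContinuityZ3.Theorems.PercNearOneGluingNoHeavyQuantFarSunCfgKron
import HarnessLib

/-!
# FAR beyond trees: per-`K` configuration-level certificates — a SHAREABLE product decomposition of the pair function

builds on p205010 (kernel theorem, internal audit signed; external expert review pending)

Support file (`--supports stmt-CriticalPhenomena-4575`), seat `prim-cert-1` (gen 26); memo `prim-cert-1/FROM-prim-cert-1-g26-CONFIG-CERTS.md` §7.
`…QuantFarSunCfgProducts` writes the pair function `Fm` (copy with coverage mask `M`, ghost at extent `E = (g, g')`) as `K+2` / `K+3` products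
whose `t`-factor depends on `M` AND whose `a`-factor depends on `E`, so every block of the Kronecker check costs `4K+10` big multiplications.
Here `Fm` is re-decomposed so that all but ONE product per direction have factors depending on (`E`, `k`) only — the indicator of bit `k` of
the copy times `a_k + b` of the ghost, for the `k` IN the coverage mask `M` — plus one product with the all-ones table; only the threshold
product `𝟙[n ≤ j] · Σa` couples `M` and `E`.  The Kronecker products of the (`E`, `k`) terms can then be computed once per ghost extent and
shared by all blocks (sequel `…QuantFarSunCfgKronShared`: `4` multiplications per block instead of `4K+10`).
* `TK.bits` (set bits of a mask below `K`), `TK.sum_map_bits`, `TK.pc_eq_card_filter`;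
* `TK.fwd2`, `TK.bwd2` (term functions `TK.fqA/ftJ/ftI/fgA`, `TK.bqT/bsT/bgT/baJ/baI`), `TK.fwd2_sum`, `TK.bwd2_sum`;
* `TK.blockTerms2`, `TK.blockTerms2_sum`, **`TK.pairing_eq_Gm2`** — the tabulated products, read as `TwoCopy.pairing`, are `TK.Gm` below `2^K`.
No sorries; standard axioms; nothing here asserts anything about a particular certificate.  Elementary [this work].
-/

namespace Summit.CriticalPhenomena.PercolationContinuityZ3.Theorems.HairyCycle

namespace TK

open Finset
open Summit.CriticalPhenomena.PercolationContinuityZ3.Theorems.TwoCopy (fib pairing)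

variable {K : ℕ}

/-! ## Set bits of a mask -/

/-- The set bits of `M` below `K`, as a list. [this work] -/
def bits (K M : ℕ) : List ℕ := (List.range K).filter fun k => M.testBit k

/-- A list sum over `bits` is a `Finset` sum over the filtered range. [this work] -/
theorem sum_map_bits (K M : ℕ) (f : ℕ → ℤ) :
    ((bits K M).map f).sum = ∑ k ∈ range K, if M.testBit k = true then f k else 0 := by
  unfold bits
  induction K with
  | zero => simp
  | succ K ih =>
    rw [Finset.sum_range_succ, List.range_succ, List.filter_append, List.map_append, List.sum_append, ih]
    congr 1
    by_cases h : M.testBit K <;> simp [h]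

/-- Popcount of `r < 2^K` as a sum of bit indicators below `K`. [this work] -/
theorem pc_eq_sum_range {r : ℕ} (hr : r < 2 ^ K) : (pc r : ℤ) = ∑ k ∈ range K, if r.testBit k = true then (1 : ℤ) else 0 := by
  rw [← Finset.sum_filter, Finset.sum_const, nsmul_eq_mul, mul_one]
  congr 1
  unfold pc
  rw [← List.toFinset_card_of_nodup Nat.bitIndices_nodup]
  congr 1
  ext i
  simp only [List.mem_toFinset, Nat.mem_bitIndices, mem_filter, mem_range]
  constructor
  · intro h
    refine ⟨?_, h⟩
    by_contra hi
    rw [Nat.testBit_lt_two_pow (lt_of_lt_of_le hr (Nat.pow_le_pow_right (by omega) (not_lt.1 hi)))] at h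
    exact Bool.false_ne_true h
  · exact fun h => h.2

/-! ## The shareable decomposition: term functions -/

/-- Forward `(i)`, ghost side: `Σa + 2j·b` at extent `(g, g')`. [this work] -/
def fqA (j : ℕ) (t : NTabs) (g g' : ℕ) : ℕ → ℕ := fun c2 => tS t g g' c2 + 2 * j * tB t g g' c2
/-- Forward `(ii)`, copy side: `−𝟙[pc(c₁ ∧ M) ≤ j]`. [this work] -/
def ftJ (j M : ℕ) : ℕ → ℤ := fun c1 => if pc (c1 &&& M) ≤ j then -1 else 0
/-- Forward `(ii)`, ghost side: `Σa`. [this work] -/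
def fsA (t : NTabs) (g g' : ℕ) : ℕ → ℕ := fun c2 => tS t g g' c2
/-- Forward `(iii)`, copy side: `−𝟙[bit k of c₁]` (independent of `M`). [this work] -/
def ftI (k : ℕ) : ℕ → ℤ := fun c1 => if c1.testBit k then -1 else 0
/-- Forward `(iii)`, ghost side: `a_k + b`. [this work] -/
def fgA (t : NTabs) (g g' k : ℕ) : ℕ → ℕ := fun c2 => tA t g g' c2 k + tB t g g' c2

/-- FORWARD shareable decomposition of `Fm` (copy `c₁` with mask `M` pays, ghost `c₂` at `(g, g')`):
`1·(Σa+2jb) − 𝟙[n₁≤j]·Σa − Σ_{k ∈ M} 𝟙[k∈c₁]·(a_k+b)`. [this work] -/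
def fwd2 (K j M : ℕ) (t : NTabs) (g g' : ℕ) : List ((ℕ → ℤ) × (ℕ → ℕ)) :=
  ((fun _ => (1 : ℤ)), fqA j t g g') :: (ftJ j M, fsA t g g') :: (bits K M).map fun k => (ftI k, fgA t g g' k)

/-- Backward `(i')`, ghost side on `c₁`: `Σa + 2j·b`. [this work] -/
def bqT (j : ℕ) (t : NTabs) (g g' : ℕ) : ℕ → ℤ := fun c1 => ((tS t g g' c1 + 2 * j * tB t g g' c1 : ℕ) : ℤ)
/-- Backward `(ii')`, ghost side: `−Σa`. [this work] -/
def bsT (t : NTabs) (g g' : ℕ) : ℕ → ℤ := fun c1 => -(tS t g g' c1 : ℤ)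
/-- Backward `(ii')`, copy side: `𝟙[pc(c₂ ∧ M') ≤ j]`. [this work] -/
def baJ (j M' : ℕ) : ℕ → ℕ := fun c2 => if pc (c2 &&& M') ≤ j then 1 else 0
/-- Backward `(iii')`, ghost side: `−(a_k + b)`. [this work] -/
def bgT (t : NTabs) (g g' k : ℕ) : ℕ → ℤ := fun c1 => -((tA t g g' c1 k + tB t g g' c1 : ℕ) : ℤ)
/-- Backward `(iii')`, copy side: `𝟙[bit k of c₂]`. [this work] -/
def baI (k : ℕ) : ℕ → ℕ := fun c2 => if c2.testBit k then 1 else 0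

/-- BACKWARD shareable decomposition of `Fm` (copy `c₂` with mask `M'` pays, ghost `c₁` at `(g, g')`):
`(Σa+2jb)·1 − Σa·𝟙[n₂≤j] − Σ_{k ∈ M'} (a_k+b)·𝟙[k∈c₂]`. [this work] -/
def bwd2 (K j M' : ℕ) (t : NTabs) (g g' : ℕ) : List ((ℕ → ℤ) × (ℕ → ℕ)) :=
  (bqT j t g g', fun _ => (1 : ℕ)) :: (bsT t g g', baJ j M') :: (bits K M').map fun k => (bgT t g g' k, baI k)

variable {am : ℕ → ℕ → ℕ → ℕ → ℕ} {bm : ℕ → ℕ → ℕ → ℕ} {j : ℕ}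

/-- `Fm` regrouped for the shareable decomposition. [this work] -/
theorem Fm_expand2 (K j : ℕ) (am : ℕ → ℕ → ℕ → ℕ → ℕ) (bm : ℕ → ℕ → ℕ → ℕ) {r : ℕ} (hr : r < 2 ^ K) (q g g' : ℕ) :
    Fm K j am bm r q g g' = ((∑ k ∈ range K, (am k q g g' : ℤ)) + 2 * j * (bm q g g' : ℤ)) +
      (if pc r ≤ j then (-1 : ℤ) else 0) * (∑ k ∈ range K, (am k q g g' : ℤ)) +
      ∑ k ∈ range K, (if r.testBit k = true then (-1 : ℤ) else 0) * ((am k q g g' : ℤ) + bm q g g') := by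
  rw [Fm_expand, pc_eq_sum_range hr]
  have e1 : ∀ k ∈ range K, (if r.testBit k = true then (-1 : ℤ) else 0) * ((am k q g g' : ℤ) + bm q g g') =
      (if r.testBit k = true then (-1 : ℤ) else 0) * (am k q g g' : ℤ) -
        (if r.testBit k = true then (1 : ℤ) else 0) * (bm q g g' : ℤ) := by
    intro k _
    split <;> ring
  rw [sum_congr rfl e1, sum_sub_distrib, ← sum_mul]
  split <;> ring

/-- The forward shareable products sum to `Fm`. [this work] -/
theorem fwd2_sum (K j M : ℕ) {g g' c2 : ℕ} (hM : M < 2 ^ K) (hg : g < K + 2) (hg' : g' < K + 1) (hc2 : c2 < 2 ^ K) (c1 : ℕ) :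
    ((fwd2 K j M (mkNTabs K am bm) g g').map (termVal c1 c2)).sum = Fm K j am bm (c1 &&& M) c2 g g' := by
  have hr : c1 &&& M < 2 ^ K := lt_of_le_of_lt Nat.and_le_right hM
  unfold fwd2
  rw [List.map_cons, List.map_cons, List.sum_cons, List.sum_cons, List.map_map]
  rw [show ((termVal c1 c2 ∘ fun k => (ftI k, fgA (mkNTabs K am bm) g g' k)) : ℕ → ℤ) =
      fun k => (if c1.testBit k = true then (-1 : ℤ) else 0) * ((tA (mkNTabs K am bm) g g' c2 k + tB (mkNTabs K am bm) g g' c2 : ℕ) : ℤ)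
      from rfl, sum_map_bits, Fm_expand2 K j am bm hr]
  simp only [termVal, fqA, ftJ, fsA]
  rw [tS_mk hg hg' hc2, tB_mk hg hg' hc2]
  have e1 : ∀ k ∈ range K, (if M.testBit k = true then
      (if c1.testBit k = true then (-1 : ℤ) else 0) * ((tA (mkNTabs K am bm) g g' c2 k + bm c2 g g' : ℕ) : ℤ) else 0) =
      (if (c1 &&& M).testBit k = true then (-1 : ℤ) else 0) * ((am k c2 g g' : ℤ) + bm c2 g g') := by
    intro k hk
    rw [tA_mk hg hg' hc2 (mem_range.1 hk), Nat.testBit_and]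
    cases c1.testBit k <;> cases M.testBit k <;> simp
  rw [sum_congr rfl e1]
  push_cast
  ring

/-- The backward shareable products sum to `Fm` (roles of the copies exchanged). [this work] -/
theorem bwd2_sum (K j M' : ℕ) {g g' c1 : ℕ} (hM : M' < 2 ^ K) (hg : g < K + 2) (hg' : g' < K + 1) (hc1 : c1 < 2 ^ K) (c2 : ℕ) :
    ((bwd2 K j M' (mkNTabs K am bm) g g').map (termVal c1 c2)).sum = Fm K j am bm (c2 &&& M') c1 g g' := by
  have hr : c2 &&& M' < 2 ^ K := lt_of_le_of_lt Nat.and_le_right hM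
  unfold bwd2
  rw [List.map_cons, List.map_cons, List.sum_cons, List.sum_cons, List.map_map]
  rw [show ((termVal c1 c2 ∘ fun k => (bgT (mkNTabs K am bm) g g' k, baI k)) : ℕ → ℤ) =
      fun k => -((tA (mkNTabs K am bm) g g' c1 k + tB (mkNTabs K am bm) g g' c1 : ℕ) : ℤ) * ((if c2.testBit k = true then 1 else 0 : ℕ) : ℤ)
      from rfl, sum_map_bits, Fm_expand2 K j am bm hr]
  simp only [termVal, bqT, bsT, baJ]
  rw [tS_mk hg hg' hc1, tB_mk hg hg' hc1]
  have e1 : ∀ k ∈ range K, (if M'.testBit k = true then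
      -((tA (mkNTabs K am bm) g g' c1 k + bm c1 g g' : ℕ) : ℤ) * ((if c2.testBit k = true then 1 else 0 : ℕ) : ℤ) else 0) =
      (if (c2 &&& M').testBit k = true then (-1 : ℤ) else 0) * ((am k c1 g g' : ℤ) + bm c1 g g') := by
    intro k hk
    rw [tA_mk hg hg' hc1 (mem_range.1 hk), Nat.testBit_and]
    cases c2.testBit k <;> cases M'.testBit k <;> simp
  rw [sum_congr rfl e1]
  push_cast
  split <;> ring

/-! ## Block terms and the `pairing` bridge -/

/-- The shareable product terms of the block `(l, m, u, v)` (same order of the four directions as `TK.blockTerms`). [this work] -/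
def blockTerms2 (K j : ℕ) (t : NTabs) (l m u v : ℕ) : List ((ℕ → ℤ) × (ℕ → ℕ)) :=
  fwd2 K j (covM K l u) t m v ++ bwd2 K j (covM K m v) t l u ++ (fwd2 K j (covM K l v) t m u ++ bwd2 K j (covM K m u) t l v)

/-- `covM < 2^K`. [this work] -/
theorem covM_lt (K l l' : ℕ) : covM K l l' < 2 ^ K :=
  enc_lt (fun _ hk => (mem_filter.1 hk).1)

/-- The shareable block terms sum to the block pair function. [this work] -/
theorem blockTerms2_sum (K j : ℕ) {l m u v c1 c2 : ℕ} (hl : l < K + 2) (hm : m < K + 2) (hu : u < K + 1) (hv : v < K + 1)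
    (hc1 : c1 < 2 ^ K) (hc2 : c2 < 2 ^ K) :
    ((blockTerms2 K j (mkNTabs K am bm) l m u v).map (termVal c1 c2)).sum = Gm K j am bm l m u v c1 c2 := by
  unfold blockTerms2 Gm
  rw [List.map_append, List.map_append, List.map_append, List.sum_append, List.sum_append, List.sum_append,
    fwd2_sum K j _ (covM_lt K l u) hm hv hc2, bwd2_sum K j _ (covM_lt K m v) hl hu hc1,
    fwd2_sum K j _ (covM_lt K l v) hm hu hc2, bwd2_sum K j _ (covM_lt K m u) hl hv hc1]

/-- **The tabulated shareable products are the block pair function** below `2^K`. [this work] -/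
theorem pairing_eq_Gm2 (K j : ℕ) {l m u v : ℕ} (hl : l < K + 2) (hm : m < K + 2) (hu : u < K + 1) (hv : v < K + 1)
    {c1 c2 : ℕ} (hc1 : c1 < 2 ^ K) (hc2 : c2 < 2 ^ K) :
    let L := blockTerms2 K j (mkNTabs K am bm) l m u v
    pairing L.length (fun p c => ((L.map fun x => tabulate (2 ^ K) x.1).getD p []).getD c 0)
      (fun c => (List.replicate (2 ^ K) (0 : ℤ)).getD c 0)
      (fun p c => ((L.map fun x => tabulate (2 ^ K) x.2).getD p []).getD c 0)
      (fun c => (List.replicate (2 ^ K) (0 : ℕ)).getD c 0) c1 c2 = Gm K j am bm l m u v c1 c2 := by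
  intro L
  unfold pairing
  dsimp only
  have h0 : (List.replicate (2 ^ K) (0 : ℤ)).getD c1 0 = 0 := by
    rw [List.getD_eq_getElem?_getD, List.getElem?_replicate]; split <;> rfl
  rw [h0, zero_mul, sub_zero]
  rw [sum_congr rfl fun p _ => by rw [getD_tabulate L (fun x => x.1) hc1 p, getD_tabulate L (fun x => x.2) hc2 p],
    sum_range_getD_mul, blockTerms2_sum K j hl hm hu hv hc1 hc2]

end TK

end Summit.CriticalPhenomena.PercolationContinuityZ3.Theorems.HairyCycle
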